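import Literature.Analysis.FluidPDE.LerayHopfRestartEverywhere
import Literature.Analysis.FluidPDE.TaoFiniteEnergyLerayHopf
import Literature.Analysis.FluidPDE.ClassicalSolutionGlue
import Summits.NavierStokesRegularity.NavierStokesRegularity.Theorems.CertifiedBlowupCertifiedBlowupAxisymBlowupBKM
import HarnessLib

/-!
# Time translation of the certificate / crux class of `CertifiedBlowupAxisymBlowup`
# (stmt-NavierStokesRegularity-0727), modulo spatial decay at the new origin

Theorems file landed `--supports stmt-NavierStokesRegularity-0727` (cell `ns-blowup`, GROUP B zone Z1, wake item (w1′) of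
`WAKE-ns-blowup-profile-eng-1-20260827T2156Z`). A witness of the crux is `(ν, T, u, p)` with the six binders
`0 < ν`, `0 < T`, `IsMaximalSmoothSolution ν 0 u p T`, `IsLerayHopfOn T ν 0 (u 0) u`, `HasRapidSpatialDecay (u 0)`,
`IsAxisymmetric (u 0)`. For `0 < t₀ < T` consider the SHIFTED PAIR `(fun s => u (s + t₀), fun s => p (s + t₀))` on
`[0, T − t₀)`. This file proves, from proved theorems of the tree only:

* (S1) `isMaximalSmoothSolution_shift` — the shifted pair is a maximal smooth solution of lifespan `T − t₀` (the tree's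
  `IsMaximalSmoothSolution.translate_zero`, Beale–Kato–Majda 1984 §1, in the crux's idiom);
* (S2) `isLerayHopfOn_shift` — **the Leray–Hopf predicate restarts at EVERY `t₀ ∈ (0, T)` with the FULL horizon
  `T − t₀`**: `IsLerayHopfOn (T − t₀) ν 0 (u t₀) (fun s => u (s + t₀))`, for every classical Leray–Hopf solution on
  `[0, T) × ℝ³`, `ν > 0` (no decay, no symmetry, no maximality). The tree restarts at every time only under strong
  `L²`-continuity on `(0, T]` INCLUDING the final time (`IsLerayHopfOn.isLerayHopfOn_translate_of_continuousInLpOn`), not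
  available at a blow-up time; here the energy inequality from `t₀` is obtained from right `L²`-continuity AT `t₀` only
  (`IsLerayHopfOn.energy_ineq_from`: the argument of the tree's `energy_ineq_every`, localised; general `E`), the
  continuity being supplied on a closed sub-slab `[0, T′]`, `t₀ < T′ < T`, by the tree's unconditional
  `isLerayHopfOn_of_finiteEnergy` (finite-energy classical solutions are Leray–Hopf with `u ∈ C([0, T′]; L²)`,
  Tao 2013 Lemma 8.1), fed with `∫|u(t)|² ≤ 2E(u 0)` (`IsLerayHopfOn.lintegral_sq_le_of_zero_force`);
* (S3) `isAxisymmetric_shift` — `IsAxisymmetric (u t₀)` (the tree's `isAxisymmetric_slice_of_lerayHopf_classical`: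
  rotation covariance + Prodi–Serrin weak–strong uniqueness; NO uniqueness hypothesis is carried);
* (S4) is NOT a theorem and is not attempted: `HasRapidSpatialDecay (u t₀)` (Schwartz type) is generically FALSE for
  `t₀ > 0` (instantaneous spreading: Brandolese–Meyer 2002; Dobrokhotov–Shafarevich moment conditions). Instead
  `decayFree_data_shift` records the DECAY-FREE data at `t₀` that DO propagate, over existing decls: `u t₀` smooth,
  divergence free, in `L²`, in `H^∞` (`∀ n, ∫⁻ ‖Dⁿu(t₀)‖ₑ² < ⊤`), and the shifted pair in the Beale–Kato–Majda class on
  every earlier slab (`∀ T″ < T − t₀, HasBoundedSobolevNormsOn (Icc 0 T″) (fun s => u (s + t₀))`,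
  `hasBoundedSobolevNormsOn_shift`) — exactly the inputs of the tree's Tao-class local theory and of the CORE
  certificate-class deposits (binder `hreg`);
* `certificateClass_shift` — assembled: THE DECAY-FREE PART OF THE CERTIFICATE CLASS IS TIME-TRANSLATION INVARIANT;
  rapid decay is an ORIGIN-ONLY hypothesis of the class.

Dictionary consequence (deposits (K82)–(K94)): every witness-form deposit consumes `HasRapidSpatialDecay (u 0)` through the
ALL-TIME lemmas `hasBoundedSobolevNormsOn_before_of_lerayHopf_classical`, `leray_le_integral_sq_norm_curl`,
`lintegral_Ioo_enstrophy_le`, so none re-instantiates BY NAME on the shifted pair without `HasRapidSpatialDecay (u t₀)`;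
the CORE theorems (binders `hcl`/`hreg`/`hslab`/`hdep`) do, with `hcl`, `hreg` shifted by this file — the late forms of
the floor chain obtained that way are the companion file `…AxisymBlowupTimeShiftLateSlab`.

No new definitions, no named-fact hypotheses, no `sorry`. WHAT THIS IS NOT: not a blow-up or regularity claim — a priori
bookkeeping about a HYPOTHETICAL witness of the crux / certificate class; cruxes 0727/8639/8640 and (AX-L) are untouched.
Author: ns-blowup-profile-eng-1 g15, 2026-08-27.

## References
* J. C. Robinson, J. L. Rodrigo, W. Sadowski, *The Three-Dimensional Navier–Stokes Equations*, CUP 2016, Def. 4.9 and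
  Cor. 4.8 (restarting from times of strong continuity). [RobinsonRodrigoSadowski2016]
* J. Serrin, in *Nonlinear Problems* (Madison 1962), Univ. Wisconsin Press 1963, §4. [Serrin1963]
* T. Tao, *Localisation and compactness properties of the Navier–Stokes global regularity problem*, Anal. PDE 6 (2013),
  Lemma 8.1. [Tao2013]
* J. T. Beale, T. Kato, A. Majda, Comm. Math. Phys. 94 (1984), §1. [BealeKatoMajda1984]
* L. Brandolese, Y. Meyer, *On the instantaneous spreading for the Navier–Stokes system in the whole space*,
  ESAIM COCV 8 (2002), 273–285. [BrandoleseMeyer2002]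
-/

-- the summit and its single problem share the name (D-0017 nested layout)
set_option linter.dupNamespace false

noncomputable section

open MeasureTheory TopologicalSpace Set Function Filter Topology Metric
open scoped InnerProductSpace RealInnerProductSpace ENNReal NNReal

/-! ### The energy inequality from a time of right `L²`-continuity, and the restart there (general `E`) -/

namespace Literature.Analysis.FluidPDE

section EveryTime

variable {E : Type*} [NormedAddCommGroup E] [InnerProductSpace ℝ E] [FiniteDimensional ℝ E]
  [MeasurableSpace E] [BorelSpace E]
variable {T ν : ℝ} {u : ℝ → E → E} {u₀ : E → E} {p : ℝ → E → ℝ}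

/-- **The energy inequality from a time `t₀` of right `L²`-continuity.** Let `u` be a Leray–Hopf weak solution of the
unforced system on `E × [0, T)` which is strongly continuous into `L²` on a closed sub-slab `[0, T′]`, and let
`0 < t₀ < T′ ≤ T`. Then, for the weak-gradient witness `G` of the Leray–Hopf structure, the energy inequality holds FROM
`t₀` up to EVERY `t ∈ [t₀, T]` (the final time included): `E(u(t)) + ν ∫_{t₀}^t ∫|G|² ≤ E(u(t₀))`. It holds from a.e.
`s' ∈ (t₀, min(t, T′))`; let `s' → t₀⁺` along such times (`E(u(s')) → E(u(t₀))` by the continuity on `[0, T′]`,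
`ContinuousInLpOn.tendsto_kineticEnergy`; `∫_{s'}^t → ∫_{t₀}^t`, `tendsto_setLIntegral_Ioo_left`). This is the tree's
`IsLerayHopfOn.energy_ineq_every` with the continuity hypothesis localised at `t₀` — continuity at the final time `T`
is NOT needed (Robinson–Rodrigo–Sadowski 2016, Def. 4.9 and Cor. 4.8). [cite: RobinsonRodrigoSadowski2016, Def. 4.9 and Cor. 4.8] -/
theorem IsLerayHopfOn.energy_ineq_from (h : IsLerayHopfOn T ν 0 u₀ u) {T' t₀ : ℝ}
    (hc : ContinuousInLpOn (Icc 0 T') 2 u) (ht₀ : 0 < t₀) (ht₀T' : t₀ < T') (hT'T : T' ≤ T) :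
    ∃ G : ℝ → E → E →L[ℝ] E,
      (∀ᵐ t ∂(volume.restrict (Ioo 0 T)), HasWeakGradient (u t) (G t)) ∧
      (∫⁻ t in Ioo 0 T, ∫⁻ x, ENNReal.ofReal (frobeniusNormSq (G t x)) < ∞) ∧
      (∀ t ∈ Icc 0 T, VectorCalculus.kineticEnergy (u t) +
        ν * (∫⁻ τ in Ioo 0 t, ∫⁻ x, ENNReal.ofReal (frobeniusNormSq (G τ x))).toReal ≤
          VectorCalculus.kineticEnergy u₀) ∧
      (∀ᵐ s ∂(volume.restrict (Ioo 0 T)), ∀ t ∈ Icc s T, VectorCalculus.kineticEnergy (u t) +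
        ν * (∫⁻ τ in Ioo s t, ∫⁻ x, ENNReal.ofReal (frobeniusNormSq (G τ x))).toReal ≤
          VectorCalculus.kineticEnergy (u s)) ∧
      (∀ t ∈ Icc t₀ T, VectorCalculus.kineticEnergy (u t) +
        ν * (∫⁻ τ in Ioo t₀ t, ∫⁻ x, ENNReal.ofReal (frobeniusNormSq (G τ x))).toReal ≤
          VectorCalculus.kineticEnergy (u t₀)) := by
  -- adapted from the tree's `IsLerayHopfOn.energy_ineq_every` (LerayHopfRestartEverywhere.lean)
  obtain ⟨G, hG, hGint, h0, hae⟩ := h.weakGrad_energy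
  have hforce : ∀ (a b : ℝ) (v : ℝ → E → E),
      ∫ τ in a..b, ∫ x, ⟪(0 : ℝ → E → E) τ x, v τ x⟫ = 0 := by
    intro a b v
    simp
  set D : ℝ → ℝ≥0∞ := fun τ => ∫⁻ x, ENNReal.ofReal (frobeniusNormSq (G τ x)) with hDdef
  have h0' : ∀ t ∈ Icc 0 T, VectorCalculus.kineticEnergy (u t) +
      ν * (∫⁻ τ in Ioo 0 t, D τ).toReal ≤ VectorCalculus.kineticEnergy u₀ := by
    intro t ht
    have h1 := h0 t ht
    rwa [hforce, add_zero] at h1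
  have hae' : ∀ᵐ s ∂(volume.restrict (Ioo 0 T)), ∀ t ∈ Icc s T, VectorCalculus.kineticEnergy (u t) +
      ν * (∫⁻ τ in Ioo s t, D τ).toReal ≤ VectorCalculus.kineticEnergy (u s) := by
    filter_upwards [hae] with s hs t ht
    have h1 := hs t ht
    rwa [hforce, add_zero] at h1
  have hT : t₀ < T := lt_of_lt_of_le ht₀T' hT'T
  refine ⟨G, hG, hGint, h0', hae', fun t ht => ?_⟩
  rcases ht.1.eq_or_lt with rfl | hst
  · -- `t = t₀`
    simp
  -- the good times in `(t₀, min t T')` accumulate at `t₀`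
  set b : ℝ := min t T' with hb
  have ht₀b : t₀ < b := lt_min hst ht₀T'
  have hbt : b ≤ t := min_le_left _ _
  have hbT' : b ≤ T' := min_le_right _ _
  set A : Set ℝ := {s' ∈ Ioo t₀ b | ∀ t' ∈ Icc s' T, VectorCalculus.kineticEnergy (u t') +
      ν * (∫⁻ τ in Ioo s' t', D τ).toReal ≤ VectorCalculus.kineticEnergy (u s')} with hA
  have hclos : t₀ ∈ closure A := by
    rw [Metric.mem_closure_iff]
    intro ε hε
    set b' : ℝ := min b (t₀ + ε) with hb'
    have hsb' : t₀ < b' := lt_min ht₀b (by linarith)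
    have hsub : Ioo t₀ b' ⊆ Ioo 0 T := fun τ hτ =>
      ⟨ht₀.trans hτ.1, (hτ.2.trans_le (min_le_left _ _)).trans_le (hbt.trans ht.2)⟩
    have hae'' : ∀ᵐ s' ∂(volume.restrict (Ioo t₀ b')), ∀ t' ∈ Icc s' T,
        VectorCalculus.kineticEnergy (u t') + ν * (∫⁻ τ in Ioo s' t', D τ).toReal ≤
          VectorCalculus.kineticEnergy (u s') :=
      ae_mono (Measure.restrict_mono hsub le_rfl) hae'
    -- an a.e. property on an interval of positive length holds somewhere in it
    obtain ⟨s', hs', hgood⟩ : ∃ s' ∈ Ioo t₀ b', ∀ t' ∈ Icc s' T,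
        VectorCalculus.kineticEnergy (u t') + ν * (∫⁻ τ in Ioo s' t', D τ).toReal ≤
          VectorCalculus.kineticEnergy (u s') := by
      by_contra hne
      push Not at hne
      have hfalse : ∀ᵐ s' ∂((volume : Measure ℝ).restrict (Ioo t₀ b')), False := by
        filter_upwards [hae'', ae_restrict_mem measurableSet_Ioo] with s' h1 h2
        obtain ⟨t', ht', hlt⟩ := hne s' h2
        exact absurd (h1 t' ht') (not_le.2 hlt)
      rw [eventually_false_iff_eq_bot, ae_eq_bot, Measure.restrict_eq_zero, Real.volume_Ioo] at hfalse
      exact absurd hfalse (ENNReal.ofReal_pos.2 (by linarith)).ne'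
    refine ⟨s', ⟨⟨hs'.1, hs'.2.trans_le (min_le_left _ _)⟩, hgood⟩, ?_⟩
    rw [Real.dist_eq, abs_sub_comm, abs_of_pos (sub_pos.2 hs'.1)]
    linarith [hs'.2.trans_le (min_le_right b (t₀ + ε))]
  haveI hne : (𝓝[A] t₀).NeBot := mem_closure_iff_nhdsWithin_neBot.1 hclos
  have hleA : 𝓝[A] t₀ ≤ 𝓝[>] t₀ := nhdsWithin_mono _ fun s' hs' => hs'.1.1
  -- along `A`: the inequality, and the two limits
  have hineq : ∀ᶠ s' in 𝓝[A] t₀, VectorCalculus.kineticEnergy (u t) +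
      ν * (∫⁻ τ in Ioo s' t, D τ).toReal ≤ VectorCalculus.kineticEnergy (u s') :=
    eventually_mem_nhdsWithin.mono fun s' hs' => hs'.2 t ⟨(hs'.1.2.trans_le hbt).le, ht.2⟩
  have hlimL : Tendsto (fun s' => VectorCalculus.kineticEnergy (u t) + ν * (∫⁻ τ in Ioo s' t, D τ).toReal)
      (𝓝[A] t₀) (𝓝 (VectorCalculus.kineticEnergy (u t) + ν * (∫⁻ τ in Ioo t₀ t, D τ).toReal)) := by
    have h1 := (tendsto_setLIntegral_Ioo_left (D := D) ht₀.le ht.2 hGint).mono_left hleA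
    have hfin : ∫⁻ τ in Ioo t₀ t, D τ ≠ ∞ :=
      (lt_of_le_of_lt (lintegral_mono_set (show Ioo t₀ t ⊆ Ioo 0 T from
        fun τ hτ => ⟨ht₀.trans hτ.1, hτ.2.trans_le ht.2⟩)) hGint).ne
    exact (((ENNReal.tendsto_toReal hfin).comp h1).const_mul ν).const_add _
  have hlimR : Tendsto (fun s' => VectorCalculus.kineticEnergy (u s')) (𝓝[A] t₀)
      (𝓝 (VectorCalculus.kineticEnergy (u t₀))) :=
    (hc.tendsto_kineticEnergy ⟨ht₀.le, ht₀T'.le⟩).mono_left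
      (nhdsWithin_mono _ (show A ⊆ Icc 0 T' from
        fun s' hs' => ⟨ht₀.le.trans hs'.1.1.le, (hs'.1.2.trans_le hbT').le⟩))
  exact le_of_tendsto_of_tendsto hlimL hlimR hineq

/-- **Restart at a time of right `L²`-continuity, with the full horizon.** Let `ν ≥ 0` and let `u` be a Leray–Hopf weak
solution of the unforced system on `E × [0, T)` from `u₀`, a classical solution on `[0, T)`, strongly continuous into
`L²` on some `[0, T′]` with `0 < t₀ < T′ ≤ T`. Then the translate `fun s => u (s + t₀)` is a Leray–Hopf weak solution on
`E × [0, T − t₀)` from the datum `u t₀` — the tree's `IsLerayHopfOn.isLerayHopfOn_translate_of_continuousInLpOn`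
verbatim, fed with `energy_ineq_from` instead of `energy_ineq_every` (weak formulation of the translate of a classical
solution `IsClassicalNSSolutionOn.isWeakNSSolutionOn_translate`; translated bounds and weak gradient; weak continuity on
`(0, T] ∋ t₀`; strong right-continuity at `t₀` from the energy inequality, `IsLerayHopfOn.tendsto_eLpNorm_sub_nhdsGT`).
[cite: RobinsonRodrigoSadowski2016, Def. 4.9 and Cor. 4.8] -/
theorem IsLerayHopfOn.isLerayHopfOn_translate_of_continuousInLpOn_Icc (hLH : IsLerayHopfOn T ν 0 u₀ u)
    (hcl : IsClassicalNSSolutionOn (Ico 0 T) ν 0 u p) (hν : 0 ≤ ν) {T' t₀ : ℝ}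
    (hc : ContinuousInLpOn (Icc 0 T') 2 u) (ht₀ : 0 < t₀) (ht₀T' : t₀ < T') (hT'T : T' ≤ T) :
    IsLerayHopfOn (T - t₀) ν 0 (u t₀) (fun t => u (t + t₀)) := by
  -- adapted from the tree's `IsLerayHopfOn.isLerayHopfOn_translate_of_continuousInLpOn`
  have hsI : t₀ ∈ Ioo 0 T := ⟨ht₀, lt_of_lt_of_le ht₀T' hT'T⟩
  obtain ⟨C, hC⟩ := hLH.energy_bound
  obtain ⟨G, hG, hGint, -, hae, hs⟩ := hLH.energy_ineq_from hc ht₀ ht₀T' hT'T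
  set g : ℝ → ℝ≥0∞ := fun τ => ∫⁻ x, ENNReal.ofReal (frobeniusNormSq (G τ x)) with hg
  have hforce : ∀ (a b : ℝ) (v : ℝ → E → E),
      ∫ τ in a..b, ∫ x, ⟪(0 : ℝ → E → E) τ x, v τ x⟫ = 0 := by
    intro a b v
    simp
  have hEs : ∀ t ∈ Icc t₀ T, VectorCalculus.kineticEnergy (u t) ≤ VectorCalculus.kineticEnergy (u t₀) := by
    intro t ht
    have h1 := hs t ht
    have h2 : 0 ≤ ν * (∫⁻ τ in Ioo t₀ t, ∫⁻ x, ENNReal.ofReal (frobeniusNormSq (G τ x))).toReal :=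
      mul_nonneg hν ENNReal.toReal_nonneg
    linarith
  have hsub : Ioo (0 + t₀) (T - t₀ + t₀) ⊆ Ioo 0 T := fun t ht =>
    ⟨by linarith [ht.1, hsI.1], by linarith [ht.2]⟩
  have hμ : volume.restrict (Ioo (0 + t₀) (T - t₀ + t₀)) ≤ volume.restrict (Ioo 0 T) :=
    Measure.restrict_mono hsub le_rfl
  have hsh : Tendsto (fun t : ℝ => t + t₀) (𝓝[>] (0 : ℝ)) (𝓝 t₀) := by
    have h1 : Tendsto (fun t : ℝ => t + t₀) (𝓝 0) (𝓝 (0 + t₀)) :=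
      (continuous_id.add continuous_const).tendsto 0
    rw [zero_add] at h1
    exact h1.mono_left nhdsWithin_le_nhds
  have hsh' : Tendsto (fun t : ℝ => t + t₀) (𝓝[>] (0 : ℝ)) (𝓝[>] t₀) := by
    refine tendsto_nhdsWithin_iff.2 ⟨hsh, ?_⟩
    filter_upwards [self_mem_nhdsWithin] with t ht
    exact show t₀ < t + t₀ by linarith [mem_Ioi.1 ht]
  refine
    { weak := ?_
      energy_bound := ⟨C, ae_restrict_Ioo_comp_add_right t₀ (ae_mono hμ hC)⟩
      memLp := fun t ht => hLH.memLp (t + t₀) ⟨by linarith [ht.1, hsI.1], by linarith [ht.2]⟩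
      weakGrad_energy := ⟨fun t => G (t + t₀), ae_restrict_Ioo_comp_add_right t₀ (ae_mono hμ hG),
        ?_, ?_, ?_⟩
      weak_continuous := fun w hw => ?_
      strong_initial := (hLH.tendsto_eLpNorm_sub_nhdsGT hsI hEs).comp hsh' }
  · -- weak formulation
    have hw := hcl.isWeakNSSolutionOn_translate ⟨C, hC⟩ ⟨hsI.1.le, hsI.2⟩
    simpa only [Pi.zero_def] using hw
  · -- `∇u(· + t₀) ∈ L²_{t,x}`
    have h1 := setLIntegral_Ioo_comp_add_right g 0 (T - t₀) t₀
    calc ∫⁻ t in Ioo 0 (T - t₀), ∫⁻ x, ENNReal.ofReal (frobeniusNormSq (G (t + t₀) x))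
        = ∫⁻ t in Ioo (0 + t₀) (T - t₀ + t₀), g t := h1
      _ ≤ ∫⁻ t in Ioo 0 T, g t := lintegral_mono_set hsub
      _ < ∞ := hGint
  · -- energy inequality from `0` (= from `t₀` for `u`)
    intro t ht
    rw [hforce, add_zero, setLIntegral_Ioo_comp_add_right g 0 t t₀, zero_add]
    exact hs (t + t₀) ⟨by linarith [ht.1], by linarith [ht.2]⟩
  · -- energy inequality from a.e. `s'`
    have h1 := ae_restrict_Ioo_comp_add_right t₀ (ae_mono hμ hae)
    filter_upwards [h1] with s' hs' t ht
    rw [hforce, add_zero, setLIntegral_Ioo_comp_add_right g s' t t₀]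
    exact hs' (t + t₀) ⟨by linarith [ht.1], by linarith [ht.2]⟩
  · -- weak `L²` continuity on `(0, T - t₀]` and the weak limit at `0⁺`
    obtain ⟨hco, -⟩ := hLH.weak_continuous w hw
    refine ⟨hco.comp (continuousOn_id.add continuousOn_const) fun t ht =>
      ⟨by linarith [ht.1, hsI.1], by linarith [ht.2]⟩, ?_⟩
    exact (hco.continuousAt (Ioc_mem_nhds hsI.1 hsI.2)).tendsto.comp hsh

/-- **Every slice of an unforced Leray–Hopf solution has `∫|u(t)|² ≤ 2E(u₀)`** (`ν ≥ 0`, every `t ∈ [0, T]`): the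
energy inequality from `s = 0` and `∫⁻ ‖u t‖ₑ² = ofReal (2 E(u t))` (`IsLerayHopfOn.eEnergy_eq`).
[cite: Leray1934, (5.2)] -/
theorem IsLerayHopfOn.lintegral_sq_le_of_zero_force (hLH : IsLerayHopfOn T ν 0 u₀ u) (hν : 0 ≤ ν) {t : ℝ}
    (ht : t ∈ Icc 0 T) :
    ∫⁻ x, ‖u t x‖ₑ ^ 2 ≤ ENNReal.ofReal (2 * VectorCalculus.kineticEnergy u₀) := by
  obtain ⟨G, -, -, h0, -⟩ := hLH.weakGrad_energy
  have h1 := h0 t ht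
  simp only [Pi.zero_apply, inner_zero_left, integral_zero, intervalIntegral.integral_zero, add_zero] at h1
  have h2 : 0 ≤ ν * (∫⁻ τ in Ioo 0 t, ∫⁻ x, ENNReal.ofReal (frobeniusNormSq (G τ x))).toReal :=
    mul_nonneg hν ENNReal.toReal_nonneg
  have h3 : ∫⁻ x, ‖u t x‖ₑ ^ 2 = eEnergy (u t) := rfl
  rw [h3, hLH.eEnergy_eq ht]
  exact ENNReal.ofReal_le_ofReal (by linarith)

end EveryTime

end Literature.Analysis.FluidPDE

/-! ### The crux class of `CertifiedBlowupAxisymBlowup`, shifted to `t₀` -/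

namespace Summit.NavierStokesRegularity.NavierStokesRegularity.Theorems.CertifiedBlowupAxisymBlowup.TimeShift

open scoped ContDiff
open Literature.Analysis.FluidPDE
open Summit.NavierStokesRegularity.NavierStokesRegularity.Theorems.CertifiedBlowupAxisymBlowup.CompactAmplification

variable {ν T : ℝ} {u : ℝ → EuclideanSpace ℝ (Fin 3) → EuclideanSpace ℝ (Fin 3)}
  {p : ℝ → EuclideanSpace ℝ (Fin 3) → ℝ}

/-- **(S1) The shifted pair is maximal with lifespan `T − t₀`** (`0 < t₀ < T`): the tree's
`IsMaximalSmoothSolution.translate_zero` (classical-solution shift; no smooth extension past `T − t₀` ⇔ none past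
`T`, `HasSmoothExtensionPast.of_translate`). [cite: BealeKatoMajda1984, §1] -/
theorem isMaximalSmoothSolution_shift (hmax : IsMaximalSmoothSolution ν 0 u p T) {t₀ : ℝ} (ht₀ : 0 < t₀)
    (ht₀T : t₀ < T) :
    IsMaximalSmoothSolution ν 0 (fun s => u (s + t₀)) (fun s => p (s + t₀)) (T - t₀) :=
  hmax.translate_zero ht₀ ht₀T

/-- **(S2) The Leray–Hopf predicate restarts at EVERY `t₀ ∈ (0, T)` with the FULL horizon `T − t₀`.** For a classical
solution on `[0, T) × ℝ³`, `ν > 0`, Leray–Hopf on `[0, T)` from `u 0`: `IsLerayHopfOn (T − t₀) ν 0 (u t₀) (u(· + t₀))`.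
NO decay, NO symmetry, NO maximality: every slice has `∫|u(t)|² ≤ 2E(u 0)` (`lintegral_sq_le_of_zero_force`), so on the
closed sub-slab `[0, T′]`, `T′ = (t₀ + T)/2`, the solution is strongly `L²`-continuous (`isLerayHopfOn_of_finiteEnergy`,
Tao 2013 Lemma 8.1, unconditional in the tree), and `isLerayHopfOn_translate_of_continuousInLpOn_Icc` restarts at `t₀`.
[cite: RobinsonRodrigoSadowski2016, Def. 4.9 and Cor. 4.8] -/
theorem isLerayHopfOn_shift (hν : 0 < ν) (hcl : IsClassicalNSSolutionOn (Ico 0 T) ν 0 u p)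
    (hLH : IsLerayHopfOn T ν 0 (u 0) u) {t₀ : ℝ} (ht₀ : 0 < t₀) (ht₀T : t₀ < T) :
    IsLerayHopfOn (T - t₀) ν 0 (u t₀) (fun s => u (s + t₀)) := by
  set T' : ℝ := (t₀ + T) / 2 with hT'
  have ht₀T' : t₀ < T' := by rw [hT']; linarith
  have hT'T : T' < T := by rw [hT']; linarith
  have hT'0 : 0 < T' := ht₀.trans ht₀T'
  have hcl' : IsClassicalNSSolutionOn (Icc 0 T') ν 0 u p :=
    hcl.mono (fun t ht => ⟨ht.1, lt_of_le_of_lt ht.2 hT'T⟩) (uniqueDiffOn_Icc hT'0)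
  have hfe : ∃ A : ℝ≥0∞, A < ⊤ ∧ ∀ t ∈ Icc 0 T', ∫⁻ x, ‖u t x‖ₑ ^ 2 ≤ A :=
    ⟨ENNReal.ofReal (2 * VectorCalculus.kineticEnergy (u 0)), ENNReal.ofReal_lt_top, fun t ht =>
      hLH.lintegral_sq_le_of_zero_force hν.le ⟨ht.1, ht.2.trans hT'T.le⟩⟩
  have hc : ContinuousInLpOn (Icc 0 T') 2 u := (isLerayHopfOn_of_finiteEnergy hcl' hν hT'0 hfe).2
  exact hLH.isLerayHopfOn_translate_of_continuousInLpOn_Icc hcl hν.le hc ht₀ ht₀T' hT'T.le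

/-- **(S3) Every slice of a witness is axisymmetric**: `IsAxisymmetric (u t₀)` for `t₀ ∈ [0, T)` — the tree's
`isAxisymmetric_slice_of_lerayHopf_classical` (rotation covariance and Prodi–Serrin weak–strong uniqueness on closed
sub-slabs; no uniqueness hypothesis is carried). The decay of the datum at the ORIGIN is used. [folklore] -/
theorem isAxisymmetric_shift (hν : 0 < ν) (hcl : IsClassicalNSSolutionOn (Ico 0 T) ν 0 u p)
    (hLH : IsLerayHopfOn T ν 0 (u 0) u) (hdec : HasRapidSpatialDecay (u 0)) (haxi : IsAxisymmetric (u 0))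
    {t₀ : ℝ} (ht₀ : 0 ≤ t₀) (ht₀T : t₀ < T) : IsAxisymmetric (u t₀) :=
  isAxisymmetric_slice_of_lerayHopf_classical hν hcl hLH hdec haxi t₀ ⟨ht₀, ht₀T⟩

/-- **The Beale–Kato–Majda class propagates to the shifted pair**: if `u` has bounded Sobolev norms of all orders on
every `[0, T″]`, `T″ < T`, then so does `u(· + t₀)` on every `[0, T″]`, `T″ < T − t₀` (`t₀ ≥ 0`; a sub-slab).
[cite: BealeKatoMajda1984, §1] -/
theorem hasBoundedSobolevNormsOn_shift (hreg : ∀ T'' < T, HasBoundedSobolevNormsOn (Icc 0 T'') u) {t₀ : ℝ}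
    (ht₀ : 0 ≤ t₀) : ∀ T'' < T - t₀, HasBoundedSobolevNormsOn (Icc 0 T'') (fun s => u (s + t₀)) := by
  intro T'' hT'' n
  obtain ⟨Cn, hCn⟩ := hreg (T'' + t₀) (by linarith) n
  exact ⟨Cn, fun s hs => hCn (s + t₀) ⟨by linarith [hs.1], by linarith [hs.2]⟩⟩

/-- **(S4′) The DECAY-FREE data at the new origin.** For a classical Leray–Hopf solution on `[0, T) × ℝ³`, `ν > 0`, from
a rapidly decaying datum and `t₀ ∈ [0, T)`: the slice `u t₀` is smooth, divergence free, square integrable and in `H^∞`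
(`∫⁻ ‖Dⁿu(t₀)‖² < ⊤` for every `n`), and the shifted pair lies in the Beale–Kato–Majda class on every earlier slab of
`[0, T − t₀)` (`hasBoundedSobolevNormsOn_before_of_lerayHopf_classical`, shifted). These are the hypotheses of the tree's
Tao-class local theory (`exists_isTaoSolutionOn_of_noSwirl` takes exactly this `H^∞` form) and of the CORE deposit
theorems (`hreg`); the Schwartz-type `HasRapidSpatialDecay (u t₀)` is NOT among them and is not claimed.
[cite: LemarieRieusset2016, Thm. 7.2 and Prop. 12.3] -/
theorem decayFree_data_shift (hν : 0 < ν) (hT : 0 < T) (hcl : IsClassicalNSSolutionOn (Ico 0 T) ν 0 u p)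
    (hLH : IsLerayHopfOn T ν 0 (u 0) u) (hdec : HasRapidSpatialDecay (u 0)) {t₀ : ℝ} (ht₀ : 0 ≤ t₀)
    (ht₀T : t₀ < T) :
    ContDiff ℝ ∞ (u t₀) ∧ VectorCalculus.IsDivFree (u t₀) ∧ MemLp (u t₀) 2 volume ∧
      (∀ n : ℕ, ∫⁻ x, ‖iteratedFDeriv ℝ n (u t₀) x‖ₑ ^ 2 < ⊤) ∧
      ∀ T'' < T - t₀, HasBoundedSobolevNormsOn (Icc 0 T'') (fun s => u (s + t₀)) := by
  have hreg := hasBoundedSobolevNormsOn_before_of_lerayHopf_classical hν hT hcl hLH hdec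
  have ht₀I : t₀ ∈ Ico 0 T := ⟨ht₀, ht₀T⟩
  refine ⟨hcl.contDiff_velocity ht₀I, hcl.divFree t₀ ht₀I, hLH.memLp t₀ ⟨ht₀, ht₀T.le⟩, fun n => ?_,
    hasBoundedSobolevNormsOn_shift hreg ht₀⟩
  obtain ⟨Cn, hCn⟩ := hreg ((t₀ + T) / 2) (by linarith) n
  exact (hCn t₀ ⟨ht₀, by linarith⟩).trans_lt ENNReal.coe_lt_top

/-- **THE DECAY-FREE PART OF THE CERTIFICATE CLASS IS TIME-TRANSLATION INVARIANT.** For every witness `(ν, T, u, p)` of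
the crux class of `CertifiedBlowupAxisymBlowup` (the six binders) and every `0 < t₀ < T`, the shifted pair
`(u(· + t₀), p(· + t₀))` is a maximal smooth solution of lifespan `T − t₀` (S1), Leray–Hopf on `[0, T − t₀)` from its
datum `u t₀` (S2), which is axisymmetric (S3), smooth, divergence free, in `L² ∩ H^∞`, with the shifted pair in the
Beale–Kato–Majda class on every earlier slab (S4′). The fourth conjunct of the class, `HasRapidSpatialDecay (u t₀)`, is an
ORIGIN-ONLY hypothesis (generically false for `t₀ > 0`: instantaneous spreading) and is not part of the conclusion.
[cite: RobinsonRodrigoSadowski2016, Def. 4.9 and Cor. 4.8; BealeKatoMajda1984, §1] -/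
theorem certificateClass_shift (hν : 0 < ν) (hT : 0 < T) (hmax : IsMaximalSmoothSolution ν 0 u p T)
    (hLH : IsLerayHopfOn T ν 0 (u 0) u) (hdec : HasRapidSpatialDecay (u 0)) (haxi : IsAxisymmetric (u 0))
    {t₀ : ℝ} (ht₀ : 0 < t₀) (ht₀T : t₀ < T) :
    IsMaximalSmoothSolution ν 0 (fun s => u (s + t₀)) (fun s => p (s + t₀)) (T - t₀) ∧
      IsLerayHopfOn (T - t₀) ν 0 ((fun s => u (s + t₀)) 0) (fun s => u (s + t₀)) ∧
      IsAxisymmetric ((fun s => u (s + t₀)) 0) ∧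
      ContDiff ℝ ∞ (u t₀) ∧ VectorCalculus.IsDivFree (u t₀) ∧ MemLp (u t₀) 2 volume ∧
      (∀ n : ℕ, ∫⁻ x, ‖iteratedFDeriv ℝ n (u t₀) x‖ₑ ^ 2 < ⊤) ∧
      ∀ T'' < T - t₀, HasBoundedSobolevNormsOn (Icc 0 T'') (fun s => u (s + t₀)) := by
  refine ⟨isMaximalSmoothSolution_shift hmax ht₀ ht₀T, ?_, ?_,
    decayFree_data_shift hν hT hmax.1 hLH hdec ht₀.le ht₀T⟩
  · simpa only [zero_add] using isLerayHopfOn_shift hν hmax.1 hLH ht₀ ht₀T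
  · simpa only [zero_add] using isAxisymmetric_shift hν hmax.1 hLH hdec haxi ht₀.le ht₀T

end Summit.NavierStokesRegularity.NavierStokesRegularity.Theorems.CertifiedBlowupAxisymBlowup.TimeShift

end
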